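import Mathlib.AlgebraicGeometry.Morphisms.Flat
import Mathlib.AlgebraicGeometry.IdealSheaf.Basic
import Mathlib.RingTheory.Regular.Flat
import HarnessLib

/-!
# B3. The lci clause restricts to smaller affine opens

OURS · L1 W4.5b · EL♮(3) `stmt-ResolutionOfSingularities-20148` · J1c brick B3 of DESIGN v2 · counted 0 (res-type-027 g16).
J1's lci clause gives, around each point of `Y₀`, an affine open `V ⊆ W₀` on which `𝓘_{Y₀}(V)` is generated by a weakly regular
sequence. The patching engine works on SMALLER affine opens `U ≤ V` (charts of `Wₙ₊₁` meeting frame charts), so we record: the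
restriction `Γ(X, V) → Γ(X, U)` between affine opens is flat (it is `Spec Γ(X,U) → Spec Γ(X,V)`, an open immersion), weakly regular
sequences survive flat base change (Mathlib `IsWeaklyRegular.of_flat`), and `𝓘(U) = 𝓘(V)·Γ(X, U)` (Mathlib `IdealSheafData.map_ideal`).
[folklore; cf. Hartshorne2010 §9 p. 80 (local nature of the lci condition)]
-/

noncomputable section

open CategoryTheory AlgebraicGeometry TopologicalSpace Opposite

namespace Summit.ResolutionOfSingularities.ResolutionOfSingularities.Cruxes.EquisingularLiftNat.Sections

/-- For affine opens `U ≤ V` of a scheme, `Spec Γ(X, U) → Spec Γ(X, V)` (the restriction) is an open immersion. [folklore] -/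
theorem isOpenImmersion_specMap_presheaf_map {X : Scheme.{0}} {U V : X.affineOpens} (h : (U : X.Opens) ≤ (V : X.Opens)) :
    IsOpenImmersion (Spec.map (X.presheaf.map (homOfLE h).op)) := by
  have e : Spec.map (X.presheaf.map (homOfLE h).op) ≫ V.2.fromSpec = U.2.fromSpec := IsAffineOpen.map_fromSpec V.2 U.2 _
  haveI : IsOpenImmersion (Spec.map (X.presheaf.map (homOfLE h).op) ≫ V.2.fromSpec) := by rw [e]; infer_instance
  exact IsOpenImmersion.of_comp _ V.2.fromSpec

/-- **Restriction between affine opens is flat**: `Γ(X, V) → Γ(X, U)` is a flat ring map for affine `U ≤ V`. [folklore] -/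
theorem flat_presheaf_map {X : Scheme.{0}} {U V : X.affineOpens} (h : (U : X.Opens) ≤ (V : X.Opens)) :
    (X.presheaf.map (homOfLE h).op).hom.Flat := by
  haveI := isOpenImmersion_specMap_presheaf_map h
  rw [← HasRingHomProperty.Spec_iff (P := @Flat)]
  infer_instance

/-- **Weakly regular sequences restrict**: a weakly regular sequence on `Γ(X, V)` stays weakly regular on `Γ(X, U)`, `U ≤ V` affine. [folklore] -/
theorem isWeaklyRegular_map_presheaf_map {X : Scheme.{0}} {U V : X.affineOpens} (h : (U : X.Opens) ≤ (V : X.Opens)) {rs : List Γ(X, V)}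
    (hreg : RingTheory.Sequence.IsWeaklyRegular Γ(X, V) rs) :
    RingTheory.Sequence.IsWeaklyRegular Γ(X, U) (rs.map (X.presheaf.map (homOfLE h).op).hom) := by
  letI := (X.presheaf.map (homOfLE h).op).hom.toAlgebra
  haveI : Module.Flat Γ(X, V) Γ(X, U) := flat_presheaf_map h
  exact hreg.of_flat

/-- **Generators restrict**: if `rs` generates `𝓘(V)` then its restriction generates `𝓘(U)` (`U ≤ V` affine). [folklore] -/
theorem ofList_map_presheaf_map_eq {X : Scheme.{0}} (I : X.IdealSheafData) {U V : X.affineOpens} (h : (U : X.Opens) ≤ (V : X.Opens))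
    {rs : List Γ(X, V)} (hgen : Ideal.ofList rs = I.ideal V) :
    Ideal.ofList (rs.map (X.presheaf.map (homOfLE h).op).hom) = I.ideal U := by
  rw [← Ideal.map_ofList, hgen]
  exact I.map_ideal (show U ≤ V from h)

/-- **B3 packaged.** From the lci clause at a point (`V` affine, `rs` weakly regular generating `𝓘(V)`), every affine `U ≤ V` inherits
weakly regular generators of `𝓘(U)`. [folklore] -/
theorem exists_isWeaklyRegular_generators_of_le {X : Scheme.{0}} (I : X.IdealSheafData) {U V : X.affineOpens} (h : (U : X.Opens) ≤ (V : X.Opens))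
    (hV : ∃ rs : List Γ(X, V), RingTheory.Sequence.IsWeaklyRegular Γ(X, V) rs ∧ Ideal.ofList rs = I.ideal V) :
    ∃ rs : List Γ(X, U), RingTheory.Sequence.IsWeaklyRegular Γ(X, U) rs ∧ Ideal.ofList rs = I.ideal U := by
  obtain ⟨rs, hreg, hgen⟩ := hV
  exact ⟨_, isWeaklyRegular_map_presheaf_map h hreg, ofList_map_presheaf_map_eq I h hgen⟩

end Summit.ResolutionOfSingularities.ResolutionOfSingularities.Cruxes.EquisingularLiftNat.Sections

end
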